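import Summits.AtomisticToContinuum.FouriersLaw.Theses.CageBudgetFekete
import Summits.AtomisticToContinuum.FouriersLaw.Theorems.HeatVarianceCeiling.Negative.LoadBearing
import Summits.AtomisticToContinuum.FouriersLaw.Theorems.HeatVarianceCeiling.Negative.Rigidity
import Summits.AtomisticToContinuum.FouriersLaw.Theorems.HeatVarianceCeiling.Negative.Envelope
import Summits.AtomisticToContinuum.FouriersLaw.Theorems.HeatVarianceCeiling.Negative.DrudeTemplate
import Summits.AtomisticToContinuum.FouriersLaw.Theorems.HeatVarianceCalculus.Negative.LoadBearing
import Summits.AtomisticToContinuum.FouriersLaw.Theorems.CageBudgetFeketeHeatVarianceCalculus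
import Summits.AtomisticToContinuum.FouriersLaw.Theorems.CurrentTiltQuenchSymmetricSetup
import Literature.MathematicalPhysics.KineticTheory.InfiniteChainShiftInvariantUniqueness

/-!
# Disproof of `HeatVarianceCeiling` (stmt-AtomisticToContinuum-15770) — findings

Crux (route CageBudgetFekete, rank 3): in the arena of the infinite pinned chain
`pinnedChain ω₂ lam β γ` (`ω₂, lam, β > 0`, `T > 0`; `μ` a shift- and reversal-invariant DLR state;
`D : InfiniteChainDynamics` with `D.PreservesMeasure μ`, a.e. shift covariance, absolutely convergent
summed current correlations, continuous `C_T = t ↦ D.currentCorrelation μ t`):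
`∃ B τ₁, ∀ τ ≥ τ₁, V_T(τ) := 2∫_{(0,τ]}(τ-s)C_T(s)ds ≤ Bτ`.
Disprover seat refuter-cdisprove-stmt-AtomisticToContinuum-15770-0, cycle 1 (2026-08-17).

VERDICT OF THE CYCLE: **no kill; the crux resists for cause.** Index of what this file records
(prose only in docstrings; every `theorem` without `sorry` is kernel-checked, the landed ones are
re-exported from `Theorems/HeatVarianceCeiling/Negative/{LoadBearing,Rigidity,Envelope,DrudeTemplate}.lean`,
proposals p160965 / p161467 / p161975 / p164117, all accepted):

* **F1 — the interface has no junk left, and no freedom either.** `InfiniteChainDynamics` has the junk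
  inhabitant `⟨∅, frozen flow, …⟩` (§1), excluded ONLY by clause (a) `∀ᵐ σ ∂μ, σ ∈ D.carrier` of
  `PreservesMeasure`; with (a), the landed rigidity theorem makes every admissible `D` agree a.e. at
  all times with the canonical Buttà–Marchioro flow, and the shift-invariant DLR state is unique, so
  `C_T` is ONE explicit function of `(ω₂, lam, β, T)` (§2, `currentCorrelation_eq_of_preservesMeasure`,
  `heatVarianceCeiling_iff_exists`). The arena is inhabited (`SymmetricSetup` proved 2026-08-17,
  `Theorems.CurrentTiltQuench.cageBudgetFekete_symmetricSetup_proof`) and the frame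
  `HeatVarianceCalculus` is proved, so the crux is NOT vacuous: it is exactly the physical statement
  "bounded Fejér means of the canonical equilibrium current memory of the closed infinite chain",
  i.e. `ρ_J([-ε,ε]) = O(ε)` — the finiteness half of Fourier's law for this chain, open in print
  (`Literature.Barriers.AtomisticToContinuum.HasBoundedResponse`).
* **F2 — LOAD-BEARING (landed):** `heatVarianceCeiling_false_without_carrierAE` — drop clause (a) and
  the statement is FALSE (frozen identity flow in the symmetric DLR state at all parameters `= 1`:
  `C ≡ c₀ > 0`, `V = c₀τ²`). Any proof must use that a.e. orbit solves Newton's equations.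
* **F3 — IDLE hypotheses (landed / in tree):** momentum-reversal invariance of `μ` is DERIVABLE
  (`HeatVarianceCalculus.Negative.map_momentumReversalZ_eq`, sibling seat); a.e. shift covariance,
  absolute convergence and continuity of `C_T` are CONSEQUENCES of `PreservesMeasure` in this arena
  (`heatVarianceCalculus_proof` (a),(b) use neither covariance nor reversal) — `heatVarianceCeiling_iff_core`
  below strips all four. `0 < T` only makes the DLR state exist; `γ` is not read by `U`, `V`.
* **F4 — the frame does not give the ceiling (landed):** `heatVarianceCeiling_not_from_decaying_memory`
  (`C(t) = (1+|t|)^{-1/2}`: continuous, `0 ≤ C ≤ C(0)`, antitone, `→ 0`, yet `V(τ) ≥ τ²/√(1+τ)`);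
  sufficient side `ceiling_of_integrable_memory` (`C ∈ L¹ ⟹ V ≤ 2‖C‖₁τ`) — the gap between the two is
  the whole crux (a RATE or CANCELLATIONS, not mixing).
* **F5 — envelope and natural strengthenings (landed, p161975):** `heatVariance_le_ballistic` — in the core
  arena `V_T(τ) ≤ C_T(0)τ²` (`|C_T| ≤ C_T(0)`, positive type of the canonical memory transferred by
  rigidity): the crux is the improvement of the exponent `2 → 1` beyond the kinetic time;
  `ceiling_iff_ceiling_from_zero` — the threshold `τ₁` is idle (`∃ B, ∀ τ ≥ 0, V ≤ Bτ` is equivalent);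
  uniform-in-`(μ,D)` constants — TRUE for free (F1); `V ≤ 2‖C‖₁τ` (absolutely integrable memory, S⁺1
  of the census) and bounded spectral density at `0` (S⁺2) — strictly stronger, same empty toolbox, not
  attacked; `lam = β = 0` (harmonic member) — the ceiling FAILS (Drude plateau of the bond current,
  `V ∼ D_h τ²`), recorded as the sorried near-miss `heatVarianceCeiling_false_at_harmonic_member` (§5:
  the infinite harmonic flow + Gaussian DLR state are not in the tree); `lam > 0, β = 0` (φ⁴) and
  `lam = 0, β > 0` (pinned FPU-β) — physically still normal conductors, so `0 < lam ∧ 0 < β` is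
  load-bearing only jointly, and only at the harmonic corner.
* **F6 — line `dual-certificate` (PICKED) pre-vetting, no stub killed:** S1–S3 LANDED meanwhile
  (`Theorems/CageBudgetFeketeHeatVarianceCeiling{BlockVariance,CoboundaryInequality,StaticFoelner}.lean`,
  2026-08-17), confirming the paper vetting: S1–S3 are sound
  (S2 needs no shift covariance: shifted orbits are orbits; `𝔼r = 0` by `integral_liouvilleZ_eq_zero` and
  oddness of `j₀`; `ProbabilityTheory.variance` is junk-`0` off `L²` but `A_n u`, `A_n r ∈ L²` under (2.3));
  S4 is the crux in Thomson form (K-functional identity) — its `br` is a `tsum` (junk `0` when not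
  summable) but `IsLocalTestFunction u` forces `u` bounded measurable local and `r = j₀ - 𝒜u` polynomially
  bounded local, whose covariance sums converge for the exponentially mixing DLR state, so no vacuous
  certificate exists; the trivial certificate `u = 0` gives `br r r = c₀ > 0`, so S4 forces
  `inf_u ⟪j₀ - 𝒜u⟫ = 0` ("no Drude weight"), consistent with F5. Numerics of the strategist (kit j024425):
  fixed-range polynomial certificates do not follow the bend of `V/τ`.
* **F7 — numerics of THIS seat (kit j026098, `kit/heatvar.py`; equilibrium MD, velocity Verlet after
  BAOAB thermalisation, `ω₂ = lam = β = 1`, rings `N = 16384`, 8 rings, `V(τ)/τ = ⟨(∫₀^τJ_tot)²⟩/(Nτ)`,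
  local exponent `α(τ) = log₂[(V/τ)(2τ)/(V/τ)(τ)]`; `α → 0` ⟺ ceiling, `α → 1` ballistic, persistent
  `0 < α < 1` anomalous; runs truncated by the wall budget at `τ_max = 512 / 256 / 253`):
  ```
  T = 1   : τ    1     2     4     8    16    32    64   128   256   512
            V/τ  0.40  0.78  1.53  2.98  5.64 10.1  17.0  26.3  39.5  58.9 (±25)
            α       0.98  0.98  0.96  0.92  0.85  0.74  0.63  0.59  0.58
            C(t)/C(0): 0.91(1) 0.85(4) 0.66(16) 0.49(32) 0.31(64) 0.18(128); 2∫₀^128 C = 41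
  T = 10  : V/τ  91   174   331   602  1026  1610  2327  3211  3823 (±990)
            α       0.94  0.92  0.86  0.77  0.65  0.53  0.47  0.25
            C(t)/C(0): 0.72(1) 0.60(4) 0.29(16) 0.16(32) 0.11(64) 0.034(128); 2∫₀^128 C = 4503
  T = 100 : V/τ  2.8e4 5.2e4 9.5e4 1.6e5 2.4e5 3.2e5 3.9e5 5.0e5 4.4e5 (±1.6e5)
            α       0.91  0.86  0.75  0.60  0.40  0.29  0.35 -0.18
            C(t)/C(0): 0.64(1) 0.41(4) 0.09(16) -0.003(32) 0.02(64);  2∫₀^32 C = 4.3e5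
  ```
  (statics check `C(0)` MD vs closed form `(T/4)E(V'(r₀)+V'(r₁))²`: 0.427/0.413, 115/118, 3.81e4/3.82e4;
  energy drift/site ≤ 1.6e-3). READING: `α(τ)` decreases MONOTONICALLY at every `T`; at `T = 100` the
  memory is dead by `t ≈ 30` and `V/τ` has saturated (`≈ 4–5·10⁵ = 2κT²`); at `T = 10` the apparent
  plateau `α ≈ 0.5` seen by the strategist up to `τ = 128` is a CROSSOVER (`α = 0.25` at the next
  doubling, running Green–Kubo integral 4.5·10³ at `t = 128` against `V/τ = 3.8·10³` at `τ = 256`); at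
  `T = 1` the kinetic time is long (`C(128)/C(0) = 0.18`) and `α = 0.58` at `τ = 512`, still falling —
  undecided at this horizon, no anomaly indicated. No numerical tension with the crux.
* **F7b — confirmatory long run (kit j026544, same script, `N = 8192`, 4 rings, `τ_max = 4096`, `dt = 0.02`,
  NOT truncated; `C(0)` MD/closed 0.433/0.418 and 118/120; energy drift/site 6.7e-6 / 1.5e-4):**
  ```
  T = 10  : τ    1     2     4     8    16    32    64   128   256   512   1024  2048
            V/τ  94    181   343   623  1058  1635  2308  3200  4466  5167  5261  5275 (±2.3e3)
            α       0.94  0.92  0.86  0.76  0.63  0.50  0.47  0.48  0.21  0.026 0.004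
            C(t)/C(0): 0.72(1) 0.59(4) 0.28(16) 0.14(32) 0.093(64) 0.10(128) -0.014(256) -0.031(512) 0.002(1000)
            2∫₀^t C : 1228(8) 2624(32) 3449(64) 5043(128) 6058(256) 5885(512) 5037(1000)
  T = 1   : V/τ  0.40  0.79  1.56  3.03  5.78  10.7  18.7  30.2  43.6  56.4  83.7  113 (±61)
            α       0.98  0.98  0.96  0.93  0.88  0.81  0.69  0.53  0.37  0.57  0.43
            C(t)/C(0): 0.91(1) 0.85(4) 0.69(16) 0.56(32) 0.39(64) 0.22(128) 0.12(256) 0.12(512) 0.045(1000)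
            2∫₀^t C : 6.3(8) 20.0(32) 33.2(64) 49.3(128) 64.0(256) 84.9(512) 129.7(1000)
  ```
  READING: at `T = 10` the variance SATURATES — `V/τ` = 5167, 5261, 5275 over the last three doublings,
  `α = 0.004` at `τ = 2048`, the memory changes sign near `t ≈ 256` and the running Green–Kubo integral
  peaks (6.1e3) and settles (≈ 5.0–5.3e3 = the plateau of `V/τ`): the ceiling holds numerically with
  `B ≈ 5.3e3`, and the strategist's `α ≈ 0.5` window (`τ ≤ 256`) is confirmed to be a crossover. At `T = 1`
  the horizon is still too short: `α` fluctuates in `0.37–0.57` within the error bars for `τ ≥ 512`, the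
  memory is positive and small (`C(1000)/C(0) = 0.045`) and `2∫₀^t C` is still rising (130 at `t = 10³`);
  kinetic scaling of the relaxation time in the effective anharmonicity (`∝ T⁻²` here) puts the `T = 1`
  saturation near `τ ~ 10⁵`, beyond an MD budget of this seat. Verdict of the numerics: normal transport
  where resolved (`T = 10, 100`), unresolved but unremarkable at `T = 1`; no numerical tension with the crux.
* **F8 — KILL TEMPLATE (landed, p164117):** `Negative.not_heatVarianceCeiling_of_cesaro_floor` — a positive Cesàro
  floor `cτ ≤ ∫₀^τ C_T` (Drude weight; Mazur from an odd conserved charge overlapping the current) for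
  ONE admissible `(μ, D)` at ONE parameter point refutes the crux (IBP `V = 2∫Φ`, rigidity, proved
  set-up); nothing feeds it today (`HiddenChargeMazur.OddChargeExists` is the disbelieved kill switch).
* **F9 — WHY IT RESISTS.** A counterexample needs too MUCH current: either a Drude atom (an odd
  `L`-invariant vector of `ℋ₀` overlapping `[j₀]`; energy, the only local conserved density, is even —
  Mazur gives nothing; no quasi-local odd charge is known or excluded) or a superdiffusive continuum
  (`ρ_J(dω) ≍ |ω|^{-a}dω`, which in one dimension needs a second conserved field, i.e. momentum — absent:
  the chain is pinned at every `T`, the quartic pinning scaling like the quartic coupling). Both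
  mechanisms are exactly what `0 < lam, 0 < β, 0 < ω₂` exclude at the harmonic corner and nothing
  suggests them inside the square; the printed consensus is diffusive transport for confining on-site potentials (Spohn, in Lepri (ed.) LNP 921
  ch. 3: "the only conserved field is the energy … all evidence points towards diffusive energy transport; for
  quadratic V and V_os = V_FPU very detailed MD confirm diffusive transport"; Lukkarinen, ibid. §4.3.4: the
  kinetic prediction for chains with anharmonic pinning is a finite non-zero `κ`; Savin–Gendelman 2003,
  doi:10.1103/physreve.67.041205: unbounded on-site potentials conduct normally at all `T`), and numerics
  (Aoki–Kusnezov φ⁴, the strategist's and this seat's MD, F7) show a finite `κ(T)`. Conversely no tool bounds `ρ_J` near `0` for a deterministic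
  anharmonic lattice (census T1–T5), so neither side closes: open problem, correctly ranked.

-- Targets: none this cycle (payload.targets = []; the lead holds S4, stub-workers S1–S3).
-/

noncomputable section

namespace Summit.AtomisticToContinuum.FouriersLaw.Cruxes.HeatVarianceCeiling.Disproof

open MeasureTheory Filter Set Topology
open Literature.MathematicalPhysics.KineticTheory.HeatConduction
open Summit.AtomisticToContinuum.FouriersLaw.Theses.CageBudgetFekete (HeatVarianceCeiling)
open Summit.AtomisticToContinuum.FouriersLaw.Theorems

/-! ## §1 Load-bearing analysis (landed as `Theorems/HeatVarianceCeiling/Negative/LoadBearing.lean`) -/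

/-- The crux with clause (a) of `PreservesMeasure` (a.e. membership in the carrier) deleted. -/
def HeatVarianceCeilingWithoutCarrierAE : Prop :=
  ∀ ω₂ lam β γ : ℝ, 0 < ω₂ → 0 < lam → 0 < β → ∀ T : ℝ, 0 < T →
    ∀ μ : MeasureTheory.Measure ChainConfig,
      (pinnedChain ω₂ lam β γ).IsChainGibbsMeasure T μ → IsShiftInvariant μ →
      μ.map (fun σ : ChainConfig => fun x : ℤ => ((σ x).1, -(σ x).2)) = μ →
      ∀ D : InfiniteChainDynamics (pinnedChain ω₂ lam β γ),
        (∀ t : ℝ, MeasurePreserving (D.flow t) μ μ) →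
        (∀ t : ℝ, ∀ᵐ σ ∂μ, D.flow t (shift σ) = shift (D.flow t σ)) →
        (∀ t : ℝ, D.HasAbsConvergentCorrelation μ t) →
        Continuous (fun t : ℝ => D.currentCorrelation μ t) →
        ∀ V : ℝ → ℝ, V = (fun τ : ℝ => 2 * ∫ s in Set.Ioc (0:ℝ) τ, (τ - s) * D.currentCorrelation μ s) →
          ∃ B τ₁ : ℝ, ∀ τ : ℝ, τ₁ ≤ τ → V τ ≤ B * τ

/-- **(a) is load-bearing** (landed, p160965): the frozen identity flow in the symmetric DLR state has
`C ≡ c₀ > 0`, `V = c₀τ²`. Any proof of the crux must use that a.e. orbit of `D` solves the equations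
of motion. -/
theorem heatVarianceCeiling_false_without_carrierAE : ¬ HeatVarianceCeilingWithoutCarrierAE :=
  HeatVarianceCeiling.Negative.heatVarianceCeiling_false_without_carrierAE

/-- The only other junk-excluding hypothesis, the DLR property, cannot be probed from the ceiling side:
every junk state compatible with a genuine or frozen dynamics in the tree (Dirac mass at rest with the
rest dynamics, the zero measure) has `C ≡ 0`, `V ≡ 0`, which SATISFIES an upper bound. Recorded as the
trivial remark that the ceiling holds for the identically vanishing memory. -/
theorem ceiling_of_zero_memory : ∃ B τ₁ : ℝ, ∀ τ : ℝ, τ₁ ≤ τ →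
    (2 * ∫ s in Set.Ioc (0:ℝ) τ, (τ - s) * (0:ℝ)) ≤ B * τ :=
  ⟨0, 0, fun τ _ => by simp⟩

/-! ## §2 Rigidity: the two universal quantifiers range over one object (landed as `Negative/Rigidity.lean`) -/

/-- The ∃-form of the crux: at every admissible parameter point SOME shift-invariant DLR state and SOME
dynamics preserving it have an eventually linear heat variance (no reversal, no shift covariance, no
convergence or continuity clause). -/
def HeatVarianceCeilingExists : Prop :=
  ∀ ω₂ lam β γ : ℝ, 0 < ω₂ → 0 < lam → 0 < β → ∀ T : ℝ, 0 < T →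
    ∃ μ : MeasureTheory.Measure ChainConfig, (pinnedChain ω₂ lam β γ).IsChainGibbsMeasure T μ ∧
      IsShiftInvariant μ ∧ ∃ D : InfiniteChainDynamics (pinnedChain ω₂ lam β γ), D.PreservesMeasure μ ∧
        ∃ B τ₁ : ℝ, ∀ τ : ℝ, τ₁ ≤ τ →
          2 * ∫ s in Set.Ioc (0:ℝ) τ, (τ - s) * D.currentCorrelation μ s ≤ B * τ

/-- The core ∀-form: the crux with the four idle hypotheses (reversal invariance, a.e. shift
covariance, absolute convergence, continuity) and the `V`-binder stripped. -/
def HeatVarianceCeilingCore : Prop :=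
  ∀ ω₂ lam β γ : ℝ, 0 < ω₂ → 0 < lam → 0 < β → ∀ T : ℝ, 0 < T →
    ∀ μ : MeasureTheory.Measure ChainConfig, (pinnedChain ω₂ lam β γ).IsChainGibbsMeasure T μ →
      IsShiftInvariant μ → ∀ D : InfiniteChainDynamics (pinnedChain ω₂ lam β γ), D.PreservesMeasure μ →
        ∃ B τ₁ : ℝ, ∀ τ : ℝ, τ₁ ≤ τ →
          2 * ∫ s in Set.Ioc (0:ℝ) τ, (τ - s) * D.currentCorrelation μ s ≤ B * τ

/-- **∃/∀ collapse.** `HeatVarianceCeiling ↔ HeatVarianceCeilingExists ↔ HeatVarianceCeilingCore`: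
(crux ⟹ ∃) instantiate at the proved symmetric set-up, whose convergence and continuity clauses are the
proved `HeatVarianceCalculus`; (∃ ⟹ core) `Negative.ceiling_transfer` (state uniqueness + rigidity);
(core ⟹ crux) forget hypotheses. So a prover may work with ONE convenient admissible dynamics (e.g. the
canonical one on `bmGood`) and a disprover with any one. -/
theorem heatVarianceCeiling_iff_exists : HeatVarianceCeiling ↔ HeatVarianceCeilingExists := by
  constructor
  · intro h ω₂ lam β γ hω hl hβ T hT
    obtain ⟨μ, hG, hS, hR, D, hP, hcov⟩ :=
      CurrentTiltQuench.cageBudgetFekete_symmetricSetup_proof ω₂ lam β γ hω hl hβ T hT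
    obtain ⟨hAC, hCc, -⟩ :=
      HeatVarianceCalculus.CanonicalRigidity.heatVarianceCalculus_proof ω₂ lam β γ hω hl hβ T hT μ hG hS
        hR D hP hcov
    obtain ⟨B, τ₁, hB⟩ := h ω₂ lam β γ hω hl hβ T hT μ hG hS hR D hP hcov hAC hCc _ rfl
    exact ⟨μ, hG, hS, D, hP, B, τ₁, hB⟩
  · intro h ω₂ lam β γ hω hl hβ T hT μ hG hS _ D hP _ _ _ V hV
    obtain ⟨μ₀, hG₀, hS₀, D₀, hP₀, B, τ₁, hB⟩ := h ω₂ lam β γ hω hl hβ T hT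
    subst hV
    exact ⟨B, τ₁, HeatVarianceCeiling.Negative.ceiling_transfer γ hω hl hβ hT hG₀ hS₀ hG hS D₀ D hP₀ hP hB⟩

/-- The crux is equivalent to its core (four idle hypotheses stripped). -/
theorem heatVarianceCeiling_iff_core : HeatVarianceCeiling ↔ HeatVarianceCeilingCore := by
  rw [heatVarianceCeiling_iff_exists]
  constructor
  · intro h ω₂ lam β γ hω hl hβ T hT μ hG hS D hP
    obtain ⟨μ₀, hG₀, hS₀, D₀, hP₀, B, τ₁, hB⟩ := h ω₂ lam β γ hω hl hβ T hT
    exact ⟨B, τ₁, HeatVarianceCeiling.Negative.ceiling_transfer γ hω hl hβ hT hG₀ hS₀ hG hS D₀ D hP₀ hP hB⟩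
  · intro h ω₂ lam β γ hω hl hβ T hT
    obtain ⟨μ, hG, hS, -, D, hP, -⟩ :=
      CurrentTiltQuench.cageBudgetFekete_symmetricSetup_proof ω₂ lam β γ hω hl hβ T hT
    exact ⟨μ, hG, hS, D, hP, h ω₂ lam β γ hω hl hβ T hT μ hG hS D hP⟩

/-- **The arena is inhabited** (so the crux is not vacuously true): at every admissible parameter point
there is an admissible `(μ, D)` satisfying ALL seven hypotheses of the crux. -/
theorem arena_inhabited (ω₂ lam β γ : ℝ) (hω : 0 < ω₂) (hl : 0 < lam) (hβ : 0 < β) (T : ℝ)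
    (hT : 0 < T) :
    ∃ (μ : MeasureTheory.Measure ChainConfig) (D : InfiniteChainDynamics (pinnedChain ω₂ lam β γ)),
      (pinnedChain ω₂ lam β γ).IsChainGibbsMeasure T μ ∧ IsShiftInvariant μ ∧
      μ.map (fun σ : ChainConfig => fun x : ℤ => ((σ x).1, -(σ x).2)) = μ ∧ D.PreservesMeasure μ ∧
      (∀ t : ℝ, ∀ᵐ σ ∂μ, D.flow t (shift σ) = shift (D.flow t σ)) ∧
      (∀ t : ℝ, D.HasAbsConvergentCorrelation μ t) ∧ Continuous (fun t : ℝ => D.currentCorrelation μ t) := by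
  obtain ⟨μ, hG, hS, hR, D, hP, hcov⟩ :=
    CurrentTiltQuench.cageBudgetFekete_symmetricSetup_proof ω₂ lam β γ hω hl hβ T hT
  obtain ⟨hAC, hCc, -⟩ :=
    HeatVarianceCalculus.CanonicalRigidity.heatVarianceCalculus_proof ω₂ lam β γ hω hl hβ T hT μ hG hS
      hR D hP hcov
  exact ⟨μ, D, hG, hS, hR, hP, hcov, hAC, hCc⟩

/-! ## §3 Idle hypotheses -/

/-- Reversal invariance of the state is derivable (sibling seat's landed lemma, re-exported). -/
theorem reversal_hypothesis_idle {ω₂ lam β : ℝ} (γ : ℝ) (hω : 0 < ω₂) (hl : 0 ≤ lam) (hβ : 0 ≤ β)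
    {T : ℝ} (hT : 0 < T) {μ : Measure ChainConfig}
    (hμ : (pinnedChain ω₂ lam β γ).IsChainGibbsMeasure T μ) (hS : IsShiftInvariant μ) :
    μ.map (fun σ : ChainConfig => fun x : ℤ => ((σ x).1, -(σ x).2)) = μ :=
  HeatVarianceCalculus.Negative.map_momentumReversalZ_eq γ hω hl hβ hT hμ hS

/-! ## §4 What the frame gives and does not give (landed) -/

/-- NOT sufficient: continuity, positivity, boundedness by `C(0)`, monotone decay to `0` (landed,
p160965). -/
theorem not_from_decaying_memory :
    ¬ (∀ C : ℝ → ℝ, Continuous C → (∀ t, 0 ≤ C t) → (∀ t, C t ≤ C 0) →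
        AntitoneOn C (Set.Ici 0) → Tendsto C atTop (𝓝 0) →
        ∀ V : ℝ → ℝ, V = (fun τ : ℝ => 2 * ∫ s in Set.Ioc (0:ℝ) τ, (τ - s) * C s) →
          ∃ B τ₁ : ℝ, ∀ τ : ℝ, τ₁ ≤ τ → V τ ≤ B * τ) :=
  HeatVarianceCeiling.Negative.heatVarianceCeiling_not_from_decaying_memory

/-- SUFFICIENT: an absolutely integrable continuous memory gives the ceiling with `B = 2‖C‖₁`,
`τ₁ = 0` (census S⁺1; the integrability clause of `FourierGreenKubo.GreenKubo`, stmt-0703). [folklore] -/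
theorem ceiling_of_integrable_memory (C : ℝ → ℝ) (hC : Continuous C)
    (hint : IntegrableOn C (Ioi 0)) :
    ∀ τ : ℝ, 0 ≤ τ → 2 * ∫ s in Set.Ioc (0:ℝ) τ, (τ - s) * C s ≤ (2 * ∫ s in Ioi (0:ℝ), |C s|) * τ := by
  intro τ hτ
  have h1 : ∫ s in Ioc (0:ℝ) τ, (τ - s) * C s ≤ ∫ s in Ioc (0:ℝ) τ, τ * |C s| := by
    refine setIntegral_mono_on ((continuous_const.sub continuous_id).mul hC).integrableOn_Ioc
      ((continuous_const.mul hC.abs).integrableOn_Ioc) measurableSet_Ioc fun s hs => ?_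
    calc (τ - s) * C s ≤ |(τ - s) * C s| := le_abs_self _
      _ = (τ - s) * |C s| := by rw [abs_mul, abs_of_nonneg (sub_nonneg.2 hs.2)]
      _ ≤ τ * |C s| := mul_le_mul_of_nonneg_right (by linarith [hs.1]) (abs_nonneg _)
  have h2 : ∫ s in Ioc (0:ℝ) τ, τ * |C s| = τ * ∫ s in Ioc (0:ℝ) τ, |C s| := integral_const_mul _ _
  have h3 : ∫ s in Ioc (0:ℝ) τ, |C s| ≤ ∫ s in Ioi (0:ℝ), |C s| :=
    setIntegral_mono_set hint.abs (Eventually.of_forall fun s => abs_nonneg _)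
      (Eventually.of_forall Ioc_subset_Ioi_self)
  have h4 : τ * ∫ s in Ioc (0:ℝ) τ, |C s| ≤ τ * ∫ s in Ioi (0:ℝ), |C s| :=
    mul_le_mul_of_nonneg_left h3 hτ
  nlinarith

/-- The Fejér form of the conclusion: for `τ > 0`, `V(τ) ≤ Bτ ↔ 2∫_{(0,τ]}(1 - s/τ)C(s)ds ≤ B` — the
ceiling is boundedness of the Fejér (Cesàro-of-Cesàro) means of the memory, nothing more and nothing
less. [folklore] -/
theorem ceiling_iff_fejer (C : ℝ → ℝ) {τ : ℝ} (hτ : 0 < τ) (B : ℝ) :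
    2 * ∫ s in Set.Ioc (0:ℝ) τ, (τ - s) * C s ≤ B * τ ↔
      2 * ∫ s in Set.Ioc (0:ℝ) τ, (1 - s / τ) * C s ≤ B := by
  have h : ∫ s in Set.Ioc (0:ℝ) τ, (τ - s) * C s = τ * ∫ s in Set.Ioc (0:ℝ) τ, (1 - s / τ) * C s := by
    rw [← integral_const_mul]
    refine integral_congr_ae (Eventually.of_forall fun s => ?_)
    show (τ - s) * C s = τ * ((1 - s / τ) * C s)
    field_simp
  rw [h]
  constructor
  · intro h1
    have : τ * (2 * ∫ s in Set.Ioc (0:ℝ) τ, (1 - s / τ) * C s) ≤ τ * B := by linarith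
    exact le_of_mul_le_mul_left this hτ
  · intro h1
    nlinarith

/-! ## §5 Near-miss: the harmonic delimiter (NOT constructible in the tree) -/

/-- The crux with the anharmonicity guards relaxed to `0 ≤ lam`, `0 ≤ β`. -/
def HeatVarianceCeilingWithoutAnharmonicity : Prop :=
  ∀ ω₂ lam β γ : ℝ, 0 < ω₂ → 0 ≤ lam → 0 ≤ β → ∀ T : ℝ, 0 < T →
    ∀ μ : MeasureTheory.Measure ChainConfig,
      (pinnedChain ω₂ lam β γ).IsChainGibbsMeasure T μ → IsShiftInvariant μ →
      μ.map (fun σ : ChainConfig => fun x : ℤ => ((σ x).1, -(σ x).2)) = μ →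
      ∀ D : InfiniteChainDynamics (pinnedChain ω₂ lam β γ), D.PreservesMeasure μ →
        (∀ t : ℝ, ∀ᵐ σ ∂μ, D.flow t (shift σ) = shift (D.flow t σ)) →
        (∀ t : ℝ, D.HasAbsConvergentCorrelation μ t) →
        Continuous (fun t : ℝ => D.currentCorrelation μ t) →
        ∀ V : ℝ → ℝ, V = (fun τ : ℝ => 2 * ∫ s in Set.Ioc (0:ℝ) τ, (τ - s) * D.currentCorrelation μ s) →
          ∃ B τ₁ : ℝ, ∀ τ : ℝ, τ₁ ≤ τ → V τ ≤ B * τ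

/-- **NEAR-MISS (sorried; the obstruction is infrastructure, not mathematics).** At `lam = β = 0`
(pinned harmonic chain, `ω(k)² = ω₂ + 4sin²(k/2)`) the Gaussian shift-invariant DLR state and the
harmonic flow on tempered configurations form an admissible pair (LLL 1977 Thm 1 applies: A4 holds for
quadratic `U`, `V`); the bond current `j_x` is NOT conserved (`C` is not `≡ C(0)`), but its diagonal
part `Σ_k ω_k ω'_k n_k` in normal modes is, the odd charges `n_k - n_{-k}` overlap it, and Mazur's bound
(`Literature.Barriers.AtomisticToContinuum.Mazur1969_inequality`) gives a Drude plateau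
`lim τ⁻¹∫₀^τ C = D_h > 0`, so `V(τ) ∼ D_h τ²` and the ceiling FAILS — the calibration point every
candidate lemma must respect (`Literature.Barriers.AtomisticToContinuum.HarmonicCrystalBallistic` is
the finite-`N` NESS form). What was tried: the tree has no infinite-volume harmonic flow as an
`InfiniteChainDynamics`, no Gaussian DLR state on `ℤ → ℝ × ℝ`, and no explicit `C_T` for it; the
Buttà–Marchioro constructions in tree require `deg U, deg V ≥ 4` with positive quartic coefficient
(`IsEvenPolyOfDegree _ 2` with `a₂ > 0`), so they do not specialise to `lam = β = 0`. Size estimate of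
the missing construction: L (Fourier-series flow + Gaussian specification + a four-point Wick
computation). Not attempted this cycle. -/
theorem heatVarianceCeiling_false_at_harmonic_member : ¬ HeatVarianceCeilingWithoutAnharmonicity := by
  sorry

/-! ## §6 Refutation template (landed as `Negative/DrudeTemplate.lean`) -/

/-- **How a kill would be filed.** A positive Cesàro floor of the memory of ONE admissible pair at ONE
parameter point refutes the crux (landed, p164117); the would-be `Refutation.lean` is the three lines
`theorem CageBudgetFeketeHeatVarianceCeiling_refuted : ¬ HeatVarianceCeiling :=
  Negative.not_heatVarianceCeiling_of_cesaro_floor γ hω hl hβ hT hG hSI D hP hc hfloor`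
once `hfloor` (a Drude weight) is in hand — it is not, and is not expected (F9). -/
theorem refutation_template {ω₂ lam β : ℝ} (γ : ℝ) (hω : 0 < ω₂) (hl : 0 < lam) (hβ : 0 < β)
    {T : ℝ} (hT : 0 < T) {μ : Measure ChainConfig}
    (hG : (pinnedChain ω₂ lam β γ).IsChainGibbsMeasure T μ) (hSI : IsShiftInvariant μ)
    (D : InfiniteChainDynamics (pinnedChain ω₂ lam β γ)) (hP : D.PreservesMeasure μ)
    {c τ₀ : ℝ} (hc : 0 < c)
    (hfloor : ∀ τ, τ₀ ≤ τ → c * τ ≤ ∫ u in (0:ℝ)..τ, D.currentCorrelation μ u) :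
    ¬ HeatVarianceCeiling :=
  HeatVarianceCeiling.Negative.not_heatVarianceCeiling_of_cesaro_floor γ hω hl hβ hT hG hSI D hP hc hfloor

end Summit.AtomisticToContinuum.FouriersLaw.Cruxes.HeatVarianceCeiling.Disproof

end
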